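import Summits.QuantumFields.BalabanUV.T4Continuum.Support.VariationalColourTaxiTowerLeaves
import Summits.QuantumFields.BalabanUV.T4Continuum.Support.VariationalColourPoincareLocal

/-!
# T⁴ programme, spine node NE2 (U1a), lane P2 — SUPPLIER ITEM «V-COL-TAXI-0FORM-END», file 1 of 2: THE NESTED OPERATOR TAXI FRAMES ARE NEAR THE STRAIGHT
# LEVEL-`k` TAXI ((E_k) for frames, k-UNIFORM under the plaquette class), and the level data ∕ class lines of the frame-free colour END at taxi data
# (model level; cell `pub-balaban`)

NE2 formalisation swarm `b2b-balaban-t4-ne2-formalise-*`, leaf prover 02 (gen 6); register P2-sup, item «V-COL-TAXI-0FORM-END» (INTENT CLAIMS.log l.17170).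
Compositions BY NAME of leaf-04-g4's operator taxi dictionary — «V-COL-TAXI» parts 1–2 (`taxiTv`, `coarseTv`, `inBlock_defect_taxiTv_adjoint_le`,
`hin_taxiTv_le`, `coarseTv_plaq_le`; p219320 ∕ p219787), «V-COL-TAXI-TOWER» parts 1, 4, 5 (`Rlev`, `nestTv`, `nestLv`, `coarseTv_eq_Rlev`, (E_k)
`nestLv_sub_lineT_le`, `inBlock_blockOf_of_bpt`; p222225 ∕ p222743 ∕ p223104).  The END itself is file 2 `VariationalColourNestedTaxiEnd`.
 * §1 THE NESTED FRAMES ARE NEAR THE STRAIGHT TAXI: `nestLv_base_eq_nestTv` (the `t = 0` member of the nested product line transports IS the nested frame at the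
   line's base site: `nestLv k y j 0 μ = nestTv k (bpt y j)`, by induction through `compL_J` ∕ `bpt_bpt`) and **`norm_nestTv_sub_taxiTv_le`** ((E_k) at `t = 0`):
   `‖nestTv k x − taxiTv (L^k) M (Rlev k) x‖ ≤ Σ_{q<k} ((d−1)+d²)·L(L^q−1)(L−1)·b_q`; `sum_step_le` ∕ **`gammaE_le`**: under the class `(L^q·L)²·b_q ≤ c` that sum is
   `≤ ((d−1)+d²)·c·(1 − L^{−k}) ≤ ((d−1)+d²)·c` (telescoping `(L−1)∕L^{q+1} = L^{−q} − L^{−(q+1)}`); **`hrel_nestTv`**: the frame-free END's relative-operator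
   binder `‖nestTv k x ∘ (taxiTv (L^k) M (coarseTv (R′ k)) x)⋆ − 1‖ ≤ ((d−1)+d²)·c` for UNITARY data, k-UNIFORM — the operator form of the U(1) road's (O10)
   `VariationalTaxiTowerEnd.hrel_taxiTower` (`4d²c` there).
 * §2 `class_bounds` (the six class lines `n·w₀ ≤ (d−1)c`, `(L²b)·n² ≤ c`, `n²·m ≤ (d−1)c`, `n·m ≤ (d−1)c`, `n²·m₁ ≤ 2(d−1)c`, `L·w₁ ≤ (d−1)c` from `(n·L)²·b ≤ c`),
   and the level data of the END in BLOCK form (one block step `(n, L)`, `N := fine n M`, `Rc := coarseTv R′`, `T₀ := taxiTv n M Rc`, `T′ := taxiTv L N R′`):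
   `hw₀_taxi` (reference in-block defect `(d−1)(n−1)·(L²b)`; base-point form `inBlock_defect_taxiTv_adjoint_le` at `(n, M)`, block form by
   `inBlock_blockOf_of_bpt` — needs `1 < M_μ`, as leaf-04-g4's part 5), `hw₁_taxi` (one-step in-block defect `(d−1)(L−1)·b`), `hin_taxi` (`m₁ = (d−1)(L−1)(2L−1)·b`).

HONEST FRAMING (T4-DAG p. 1).  Bookkeeping at MODEL level (bond operators DATA; taxi ∕ straight contours OURS; [Balaban1985BackgroundPropagators] (3.10) ∕ (3.15) ∕
(3.19) SHAPES only, no B0, c5); [folklore] ordered-product bookkeeping + real arithmetic; nothing printed is a hypothesis; no `def`, no `def … : Prop`, no `sorry`;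
axioms standard.  NE2 NOT proved on either road; NE3 OPEN; spine PROVED 0∕9 unchanged; rung (B)+1 finite T⁴ — NOT infinite volume, NOT mass gap, NOT Clay.  HONEST
DEPENDENCY (cell, verbatim): continuum YM on T⁴ ⇐ BetaPertH ∧ nine spine estimates (0/9 proved); BetaPertH ⇐ (D1) ∧ (D4) ∧ CAP+tail; G-an2-4 gates asym, D1
and NE2/3/4.
-/

noncomputable section

namespace Summit.QuantumFields.BalabanUV.T4Continuum.VariationalColourNestedTaxiFrames

open Finset
open scoped Matrix
open Literature.MathematicalPhysics.QuantumFieldTheory.Balaban1983to89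
open Literature.MathematicalPhysics.QuantumFieldTheory.Balaban1983to89.B5Prop11Plancherel (Tor fine unitVec)
open Literature.MathematicalPhysics.QuantumFieldTheory.Balaban1983to89.B5Block118 (tstep tstep_zero bpt)
open Literature.MathematicalPhysics.QuantumFieldTheory.Balaban1983to89.B5Blocks16 (blockOf blockOf_bpt bpt_bijective)
open Literature.MathematicalPhysics.QuantumFieldTheory.Balaban1983to89.B5Composition116 (sites bpt_bpt J JEquiv JEquiv_apply)
open Summit.QuantumFields.BalabanUV.T4Continuum.VariationalColourFederbush (piTv misv norm_le_one_of_mem_unitary)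
open Summit.QuantumFields.BalabanUV.T4Continuum.VariationalColourTower (compTv Rtrv)
open Summit.QuantumFields.BalabanUV.T4Continuum.VariationalVectorFederbush (lineT)
open Summit.QuantumFields.BalabanUV.T4Continuum.VectorBlockTrialForm (compL compL_J val_finProdFinEquiv)
open Summit.QuantumFields.BalabanUV.T4Continuum.VariationalColourTaxiTransport
open Summit.QuantumFields.BalabanUV.T4Continuum.VariationalColourPoincareLocal (norm_rel_eq)

variable {d : ℕ}

/-! ## §1 The nested operator taxi frames are near the straight level-`k` taxi -/

section Frames

variable {E : Type*} [NormedAddCommGroup E] [NormedSpace ℂ E]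
variable (L : ℕ) [NeZero L] (M : Fin d → ℕ) [hM : ∀ μ, NeZero (M μ)]
variable (R' : (k : ℕ) → Tor (fine L (fine (L ^ k) M)) → Fin d → (E →L[ℂ] E))

/-- **the `t = 0` member of the nested product line transports IS the nested frame at the line's base site**: `nestLv k y j 0 μ = nestTv k (bpt (L^k) M y j)`
(induction over the tower: `compL_J` at the split position `(0, 0)`, `lineT T′ R′ y j 0 ν = T′(bpt y j)`, and the block nesting `bpt_bpt`). [folklore] -/
theorem nestLv_base_eq_nestTv : ∀ (k : ℕ) (y : Tor M) (j : Fin d → Fin (L ^ k)) (μ : Fin d),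
    nestLv L M R' k y j 0 μ = nestTv L M R' k (bpt (L ^ k) M y j)
  | 0, _, _, _ => rfl
  | k + 1, y, j, μ => by
    obtain ⟨⟨j₂, j₁⟩, rfl⟩ := (JEquiv (L ^ k) L).surjective j
    have h0 : (0 : Fin (L ^ (k + 1))) = finProdFinEquiv ((0 : Fin (L ^ k)), (0 : Fin L)) :=
      Fin.ext (by rw [val_finProdFinEquiv]; simp)
    rw [JEquiv_apply]
    dsimp only
    rw [nestLv_succ, nestTv_succ, h0, compL_J, nestLv_base_eq_nestTv k y j₂ μ]
    simp only [compTv, lineT, Fin.val_zero, tstep_zero, add_zero, piTv, mul_one]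
    show _ = nestTv L M R' k (blockOf L (fine (L ^ k) M) (sites (L ^ k) L M (bpt (L ^ k * L) M y (J (L ^ k) L j₂ j₁))))
      * taxiTv L (fine (L ^ k) M) (R' k) (sites (L ^ k) L M (bpt (L ^ k * L) M y (J (L ^ k) L j₂ j₁)))
    rw [← bpt_bpt, blockOf_bpt]

variable {R'}

/-- **(E_k) FOR FRAMES: THE NESTED OPERATOR TAXI IS NEAR THE STRAIGHT LEVEL-`k` TAXI** — `‖nestTv k x − taxiTv (L^k) M (Rlev k) x‖ ≤ Σ_{q<k} ((d−1)+d²)·L(L^q−1)(L−1)·b_q`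
along a COHERENT tower of contractive one-step bond operators with one-step plaquette defects `b_q` (leaf-04-g4's `nestLv_sub_lineT_le` at `t = 0`). [folklore] -/
theorem norm_nestTv_sub_taxiTv_le (hd : 0 < d) (hR' : ∀ k x μ, ‖R' k x μ‖ ≤ 1) {b : ℕ → ℝ}
    (hb : ∀ k x κ ι, ‖R' k x κ * R' k (x + unitVec (fine L (fine (L ^ k) M)) κ) ι - R' k x ι * R' k (x + unitVec (fine L (fine (L ^ k) M)) ι) κ‖ ≤ b k)
    (hcoh : ∀ k, coarseTv L (fine (L ^ (k + 1)) M) (R' (k + 1)) = Rtrv (L ^ k) L M (R' k)) (k : ℕ) (x : Tor (fine (L ^ k) M)) :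
    ‖nestTv L M R' k x - taxiTv (L ^ k) M (Rlev L M R' k) x‖
      ≤ ∑ q ∈ Finset.range k, ((((d - 1 : ℕ) : ℝ) + (d : ℝ) * d) * (((L : ℝ) * ((L ^ q - 1 : ℕ) : ℝ) * ((L - 1 : ℕ) : ℝ)) * b q)) := by
  obtain ⟨⟨y, j⟩, rfl⟩ := (bpt_bijective (L ^ k) M).2 x
  have h := nestLv_sub_lineT_le L M hR' hb hcoh k y j 0 ⟨0, hd⟩
  rw [nestLv_base_eq_nestTv] at h
  simpa only [lineT, Fin.val_zero, piTv, mul_one] using h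

omit [NeZero L] hM in
/-- one term of (E_k) under the class: `L(L^q−1)(L−1)·b_q ≤ c·(L^{−q} − L^{−(q+1)})` from `(L^q·L)²·b_q ≤ c`. [folklore] -/
theorem sum_step_le (hL1 : (1 : ℝ) ≤ L) {b : ℕ → ℝ} (hb0 : ∀ k, 0 ≤ b k) {c : ℝ} (hclass : ∀ k, ((((L ^ k : ℕ)) : ℝ) * L) ^ 2 * b k ≤ c) (q : ℕ) :
    (L : ℝ) * ((L ^ q - 1 : ℕ) : ℝ) * ((L - 1 : ℕ) : ℝ) * b q ≤ c * (((L : ℝ)⁻¹) ^ q - ((L : ℝ)⁻¹) ^ (q + 1)) := by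
  have hnm1 : ((L ^ q - 1 : ℕ) : ℝ) ≤ (((L ^ q : ℕ)) : ℝ) := Nat.cast_le.mpr (Nat.sub_le (L ^ q) 1)
  have hn1 : (1 : ℝ) ≤ (((L ^ q : ℕ)) : ℝ) := by push_cast; exact one_le_pow₀ hL1
  have hninv : ((((L ^ q : ℕ)) : ℝ))⁻¹ = ((L : ℝ)⁻¹) ^ q := by push_cast; rw [inv_pow]
  have hn0 : (0 : ℝ) < (((L ^ q : ℕ)) : ℝ) := by linarith
  set n : ℝ := (((L ^ q : ℕ)) : ℝ)
  have hL0 : (0 : ℝ) < L := by linarith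
  have hLm1 : ((L - 1 : ℕ) : ℝ) = L - 1 := by
    rw [Nat.cast_sub (by exact_mod_cast hL1), Nat.cast_one]
  have hnm0 : 0 ≤ ((L ^ q - 1 : ℕ) : ℝ) := Nat.cast_nonneg _
  -- the right-hand side is `c·(L−1)/(n·L)`
  have hrhs : c * (((L : ℝ)⁻¹) ^ q - ((L : ℝ)⁻¹) ^ (q + 1)) = c * (L - 1) / (n * L) := by
    rw [pow_succ, ← hninv]
    field_simp
  rw [hrhs, hLm1, le_div_iff₀ (by positivity)]
  have hcl := hclass q
  have hb := hb0 q
  -- `L·(L^q−1)·(L−1)·b·(n·L) ≤ L·n·(L−1)·b·(n·L) = (L−1)·((n·L)²·b) ≤ (L−1)·c`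
  have h1 : (L : ℝ) * ((L ^ q - 1 : ℕ) : ℝ) * ((L : ℝ) - 1) * b q * (n * L) ≤ (L : ℝ) * n * ((L : ℝ) - 1) * b q * (n * L) := by
    have h0 : 0 ≤ (L : ℝ) * ((L : ℝ) - 1) * b q * (n * L) := by
      have : (0 : ℝ) ≤ (L : ℝ) - 1 := by linarith
      positivity
    nlinarith [mul_le_mul_of_nonneg_left hnm1 h0]
  calc (L : ℝ) * ((L ^ q - 1 : ℕ) : ℝ) * ((L : ℝ) - 1) * b q * (n * L)
      ≤ (L : ℝ) * n * ((L : ℝ) - 1) * b q * (n * L) := h1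
    _ = ((L : ℝ) - 1) * ((n * L) ^ 2 * b q) := by ring
    _ ≤ ((L : ℝ) - 1) * c := mul_le_mul_of_nonneg_left hcl (by linarith)
    _ = c * ((L : ℝ) - 1) := mul_comm _ _

omit [NeZero L] hM in
/-- **`γ_k ≤ ((d−1)+d²)·c`, k-UNIFORM**: the (E_k) sum under the class telescopes to `((d−1)+d²)·c·(1 − L^{−k})`. [folklore] -/
theorem gammaE_le (hL1 : (1 : ℝ) ≤ L) {b : ℕ → ℝ} (hb0 : ∀ k, 0 ≤ b k) {c : ℝ} (hclass : ∀ k, ((((L ^ k : ℕ)) : ℝ) * L) ^ 2 * b k ≤ c) (k : ℕ) :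
    ∑ q ∈ Finset.range k, ((((d - 1 : ℕ) : ℝ) + (d : ℝ) * d) * (((L : ℝ) * ((L ^ q - 1 : ℕ) : ℝ) * ((L - 1 : ℕ) : ℝ)) * b q))
      ≤ (((d - 1 : ℕ) : ℝ) + (d : ℝ) * d) * c := by
  have hD : 0 ≤ (((d - 1 : ℕ) : ℝ) + (d : ℝ) * d) := by positivity
  have hc0 : 0 ≤ c := le_trans (by have := hb0 0; positivity) (hclass 0)
  have hθ0 : (0 : ℝ) ≤ (L : ℝ)⁻¹ := inv_nonneg.mpr (by linarith)
  have hstep : ∀ q ∈ Finset.range k, ((((d - 1 : ℕ) : ℝ) + (d : ℝ) * d) * (((L : ℝ) * ((L ^ q - 1 : ℕ) : ℝ) * ((L - 1 : ℕ) : ℝ)) * b q))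
      ≤ ((((d - 1 : ℕ) : ℝ) + (d : ℝ) * d) * c) * (((L : ℝ)⁻¹) ^ q - ((L : ℝ)⁻¹) ^ (q + 1)) := fun q _ => by
    have h := sum_step_le L hL1 hb0 hclass q
    calc ((((d - 1 : ℕ) : ℝ) + (d : ℝ) * d) * (((L : ℝ) * ((L ^ q - 1 : ℕ) : ℝ) * ((L - 1 : ℕ) : ℝ)) * b q))
        = (((d - 1 : ℕ) : ℝ) + (d : ℝ) * d) * ((L : ℝ) * ((L ^ q - 1 : ℕ) : ℝ) * ((L - 1 : ℕ) : ℝ) * b q) := by ring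
      _ ≤ (((d - 1 : ℕ) : ℝ) + (d : ℝ) * d) * (c * (((L : ℝ)⁻¹) ^ q - ((L : ℝ)⁻¹) ^ (q + 1))) := mul_le_mul_of_nonneg_left h hD
      _ = _ := by ring
  refine (Finset.sum_le_sum hstep).trans ?_
  rw [← Finset.mul_sum, Finset.sum_range_sub']
  have hk : 0 ≤ ((L : ℝ)⁻¹) ^ k := pow_nonneg hθ0 k
  have hDc : 0 ≤ ((((d - 1 : ℕ) : ℝ) + (d : ℝ) * d) * c) := mul_nonneg hD hc0
  calc ((((d - 1 : ℕ) : ℝ) + (d : ℝ) * d) * c) * (((L : ℝ)⁻¹) ^ 0 - ((L : ℝ)⁻¹) ^ k)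
      ≤ ((((d - 1 : ℕ) : ℝ) + (d : ℝ) * d) * c) * 1 := mul_le_mul_of_nonneg_left (by rw [pow_zero]; linarith) hDc
    _ = _ := mul_one _

end Frames

section FramesUnitary

variable {H : Type*} [NormedAddCommGroup H] [InnerProductSpace ℂ H] [CompleteSpace H]
variable (L : ℕ) [NeZero L] (M : Fin d → ℕ) [hM : ∀ μ, NeZero (M μ)]

/-- **THE END's RELATIVE-OPERATOR BINDER AT TAXI DATA**: along a COHERENT tower of UNITARY one-step bond operators in the class `(L^q·L)²·b_q ≤ c`, the nested frames
against the straight level-`k` taxi of the coarse bonds `coarseTv (R′ k)` (= `Rlev k` by coherence):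
`‖nestTv k x ∘ (taxiTv (L^k) M (coarseTv L (fine (L^k) M) (R′ k)) x)⋆ − 1‖ ≤ ((d−1)+d²)·c`, k-UNIFORM. [folklore] -/
theorem hrel_nestTv (hd : 0 < d) (hL1 : (1 : ℝ) ≤ L) {R' : (k : ℕ) → Tor (fine L (fine (L ^ k) M)) → Fin d → (H →L[ℂ] H)}
    (hU : ∀ k x μ, R' k x μ ∈ unitary (H →L[ℂ] H)) {b : ℕ → ℝ} (hb0 : ∀ k, 0 ≤ b k)
    (hb : ∀ k x κ ι, ‖R' k x κ * R' k (x + unitVec (fine L (fine (L ^ k) M)) κ) ι - R' k x ι * R' k (x + unitVec (fine L (fine (L ^ k) M)) ι) κ‖ ≤ b k)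
    (hcoh : ∀ k, coarseTv L (fine (L ^ (k + 1)) M) (R' (k + 1)) = Rtrv (L ^ k) L M (R' k))
    {c : ℝ} (hclass : ∀ k, ((((L ^ k : ℕ)) : ℝ) * L) ^ 2 * b k ≤ c) (k : ℕ) (x : Tor (fine (L ^ k) M)) :
    ‖nestTv L M R' k x * star (taxiTv (L ^ k) M (coarseTv L (fine (L ^ k) M) (R' k)) x) - 1‖ ≤ (((d - 1 : ℕ) : ℝ) + (d : ℝ) * d) * c := by
  have hR' : ∀ k x μ, ‖R' k x μ‖ ≤ 1 := fun k x μ => norm_le_one_of_mem_unitary (hU k x μ)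
  rw [coarseTv_eq_Rlev L M R' hcoh k]
  have hT₀ : taxiTv (L ^ k) M (Rlev L M R' k) x ∈ unitary (H →L[ℂ] H) := taxiTv_mem_unitary (L ^ k) M (Rlev_mem_unitary L M hU k) x
  rw [← norm_rel_eq (L ^ k) M (T := nestTv L M R' k) (T₀ := taxiTv (L ^ k) M (Rlev L M R' k)) (fun x => taxiTv_mem_unitary (L ^ k) M
    (Rlev_mem_unitary L M hU k) x) x, one_mul, norm_sub_rev]
  exact (norm_nestTv_sub_taxiTv_le L M hd hR' hb hcoh k x).trans (gammaE_le L hL1 hb0 hclass k)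

end FramesUnitary

/-! ## §2 The level data of the END at taxi data (one block step) and the class ∕ smallness lines -/

section Arith

/-- **THE CLASS LINES AT TAXI DATA** from `(n·L)²·b ≤ c` (`1 ≤ n`, `1 ≤ L`): reference `n·w₀ ≤ (d−1)c`, plaquette `(L²b)·n² ≤ c`, FED⁺ `n²·m ≤ (d−1)c` and
`n·m ≤ (d−1)c`, ONE⁺ `n²·m₁ ≤ 2(d−1)c`, one-step P⁺ `L·w₁ ≤ (d−1)c`. [folklore] -/
theorem class_bounds {n L : ℕ} (hn : 1 ≤ n) (hL : 1 ≤ L) {b : ℝ} (hb0 : 0 ≤ b) {c : ℝ} (hc : ((n : ℝ) * L) ^ 2 * b ≤ c) :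
    (n : ℝ) * (((d - 1 : ℕ) : ℝ) * ((n - 1 : ℕ) : ℝ) * ((L : ℝ) * L * b)) ≤ ((d - 1 : ℕ) : ℝ) * c ∧
      (L : ℝ) * L * b * (n : ℝ) ^ 2 ≤ c ∧
      (n : ℝ) ^ 2 * (((d - 1 : ℕ) : ℝ) * L * ((L - 1 : ℕ) : ℝ) * b) ≤ ((d - 1 : ℕ) : ℝ) * c ∧
      (n : ℝ) * (((d - 1 : ℕ) : ℝ) * L * ((L - 1 : ℕ) : ℝ) * b) ≤ ((d - 1 : ℕ) : ℝ) * c ∧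
      (n : ℝ) ^ 2 * (((d - 1 : ℕ) : ℝ) * ((L - 1 : ℕ) : ℝ) * ((2 * L - 1 : ℕ) : ℝ) * b) ≤ 2 * ((d - 1 : ℕ) : ℝ) * c ∧
      (L : ℝ) * (((d - 1 : ℕ) : ℝ) * ((L - 1 : ℕ) : ℝ) * b) ≤ ((d - 1 : ℕ) : ℝ) * c := by
  have hd : 0 ≤ ((d - 1 : ℕ) : ℝ) := Nat.cast_nonneg _
  have hnr : (1 : ℝ) ≤ n := by exact_mod_cast hn
  have hLr : (1 : ℝ) ≤ L := by exact_mod_cast hL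
  have hn1 : ((n - 1 : ℕ) : ℝ) = n - 1 := by rw [Nat.cast_sub hn, Nat.cast_one]
  have hL1 : ((L - 1 : ℕ) : ℝ) = L - 1 := by rw [Nat.cast_sub hL, Nat.cast_one]
  have h2L : ((2 * L - 1 : ℕ) : ℝ) = 2 * L - 1 := by rw [Nat.cast_sub (by omega), Nat.cast_mul, Nat.cast_two, Nat.cast_one]
  have hbase : (n : ℝ) ^ 2 * ((L : ℝ) * L * b) ≤ c := by nlinarith
  have hn2 : (n : ℝ) ≤ (n : ℝ) ^ 2 := by nlinarith
  have hLL : (L : ℝ) * ((L : ℝ) - 1) ≤ (L : ℝ) * L := by nlinarith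
  have hLL0 : 0 ≤ (L : ℝ) * ((L : ℝ) - 1) := by nlinarith
  have hnLL : (L : ℝ) * L ≤ (n : ℝ) ^ 2 * ((L : ℝ) * L) := by nlinarith
  have h2LL : ((L : ℝ) - 1) * (2 * (L : ℝ) - 1) ≤ 2 * ((L : ℝ) * L) := by nlinarith
  have hn2b : 0 ≤ (n : ℝ) ^ 2 * b := by positivity
  rw [hn1, hL1, h2L]
  refine ⟨?_, by nlinarith, ?_, ?_, ?_, ?_⟩
  · -- `n·(d−1)(n−1)·L²b ≤ (d−1)·n²L²b ≤ (d−1)c`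
    have h1 : (n : ℝ) * ((n : ℝ) - 1) * ((L : ℝ) * L * b) ≤ (n : ℝ) ^ 2 * ((L : ℝ) * L * b) := by nlinarith
    nlinarith [mul_le_mul_of_nonneg_left (h1.trans hbase) hd]
  · -- `n²·(d−1)L(L−1)b ≤ (d−1)·n²L²b`
    have h1 : (n : ℝ) ^ 2 * ((L : ℝ) * ((L : ℝ) - 1) * b) ≤ (n : ℝ) ^ 2 * ((L : ℝ) * L * b) := by
      nlinarith [mul_le_mul_of_nonneg_left hLL hn2b]
    nlinarith [mul_le_mul_of_nonneg_left (h1.trans hbase) hd]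
  · -- `n·(d−1)L(L−1)b ≤ n²·… ≤ (d−1)c`
    have h1 : (n : ℝ) * ((L : ℝ) * ((L : ℝ) - 1) * b) ≤ (n : ℝ) ^ 2 * ((L : ℝ) * L * b) := by
      have e1 : (n : ℝ) * ((L : ℝ) * ((L : ℝ) - 1) * b) ≤ (n : ℝ) ^ 2 * ((L : ℝ) * ((L : ℝ) - 1) * b) :=
        mul_le_mul_of_nonneg_right hn2 (mul_nonneg hLL0 hb0)
      nlinarith [mul_le_mul_of_nonneg_left hLL hn2b]
    nlinarith [mul_le_mul_of_nonneg_left (h1.trans hbase) hd]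
  · -- `n²·(d−1)(L−1)(2L−1)b ≤ 2(d−1)·n²L²b`
    have h1 : (n : ℝ) ^ 2 * (((L : ℝ) - 1) * (2 * (L : ℝ) - 1) * b) ≤ 2 * ((n : ℝ) ^ 2 * ((L : ℝ) * L * b)) := by
      nlinarith [mul_le_mul_of_nonneg_left h2LL hn2b]
    nlinarith [mul_le_mul_of_nonneg_left (h1.trans (by linarith : 2 * ((n : ℝ) ^ 2 * ((L : ℝ) * L * b)) ≤ 2 * c)) hd]
  · -- `L·(d−1)(L−1)b ≤ (d−1)·n²L²b`
    have h1 : (L : ℝ) * (((L : ℝ) - 1) * b) ≤ (n : ℝ) ^ 2 * ((L : ℝ) * L * b) := by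
      have e1 : (L : ℝ) * (((L : ℝ) - 1) * b) = ((L : ℝ) * ((L : ℝ) - 1)) * b := by ring
      rw [e1]
      nlinarith [mul_le_mul_of_nonneg_right (hLL.trans hnLL) hb0]
    nlinarith [mul_le_mul_of_nonneg_left (h1.trans hbase) hd]

/-- a square bound `4x² ≤ ½` forces `x < 1`. [folklore] -/
theorem lt_one_of_four_sq_le {x : ℝ} (hx : 4 * x ^ 2 ≤ 1 / 2) : x < 1 := by nlinarith

end Arith

section Step

variable {H : Type*} [NormedAddCommGroup H] [InnerProductSpace ℂ H] [CompleteSpace H]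
variable (n L : ℕ) [NeZero n] [NeZero L] (M : Fin d → ℕ) [hM : ∀ μ, NeZero (M μ)]
variable {R' : Tor (fine L (fine n M)) → Fin d → (H →L[ℂ] H)} (hU : ∀ x μ, R' x μ ∈ unitary (H →L[ℂ] H)) {b : ℝ}
  (hb : ∀ x κ ι, ‖R' x κ * R' (x + unitVec (fine L (fine n M)) κ) ι - R' x ι * R' (x + unitVec (fine L (fine n M)) ι) κ‖ ≤ b)
include hU hb

/-- **THE REFERENCE IN-BLOCK DEFECT AT TAXI DATA, BLOCK FORM** (`Rc := coarseTv R′`, `T₀ := taxiTv n M Rc`, plaquette defect of `Rc` `≤ L²b` by `coarseTv_plaq_le`;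
base-point form by `inBlock_defect_taxiTv_adjoint_le` at `(n, M)`, block form by `inBlock_blockOf_of_bpt`, `1 < M_μ`): `w₀ = (d−1)(n−1)·(L·L·b)`. [folklore] -/
theorem hw₀_taxi (hM2 : ∀ μ, 1 < M μ) (x : Tor (fine n M)) (μ : Fin d) (hx : blockOf n M (x + unitVec (fine n M) μ) = blockOf n M x) :
    ‖coarseTv L (fine n M) R' x μ * star (taxiTv n M (coarseTv L (fine n M) R') (x + unitVec (fine n M) μ)) * taxiTv n M (coarseTv L (fine n M) R') x - 1‖
      ≤ ((d - 1 : ℕ) : ℝ) * ((n - 1 : ℕ) : ℝ) * ((L : ℝ) * L * b) := by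
  have hR' : ∀ x μ, ‖R' x μ‖ ≤ 1 := fun x μ => norm_le_one_of_mem_unitary (hU x μ)
  exact inBlock_blockOf_of_bpt n M hM2
    (P := fun x μ => ‖coarseTv L (fine n M) R' x μ * star (taxiTv n M (coarseTv L (fine n M) R') (x + unitVec (fine n M) μ))
      * taxiTv n M (coarseTv L (fine n M) R') x - 1‖ ≤ ((d - 1 : ℕ) : ℝ) * ((n - 1 : ℕ) : ℝ) * ((L : ℝ) * L * b))
    (fun y j μ h => inBlock_defect_taxiTv_adjoint_le n M (coarseTv_mem_unitary L (fine n M) hU) (coarseTv_plaq_le L (fine n M) hR' hb) y j μ h) x μ hx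

/-- **THE ONE-STEP IN-BLOCK DEFECT AT TAXI DATA, BLOCK FORM** (`T′ := taxiTv L N R′`, `N := fine n M`, `1 < M_μ`): `w₁ = (d−1)(L−1)·b`. [folklore] -/
theorem hw₁_taxi (hM2 : ∀ μ, 1 < M μ) (x : Tor (fine L (fine n M))) (μ : Fin d)
    (hx : blockOf L (fine n M) (x + unitVec (fine L (fine n M)) μ) = blockOf L (fine n M) x) :
    ‖R' x μ * star (taxiTv L (fine n M) R' (x + unitVec (fine L (fine n M)) μ)) * taxiTv L (fine n M) R' x - 1‖ ≤ ((d - 1 : ℕ) : ℝ) * ((L - 1 : ℕ) : ℝ) * b := by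
  have hN2 : ∀ μ, 1 < fine n M μ := fun μ => by
    have h1 : 1 ≤ n := Nat.one_le_iff_ne_zero.mpr (NeZero.ne n)
    show 1 < n * M μ
    calc 1 < M μ := hM2 μ
      _ ≤ n * M μ := Nat.le_mul_of_pos_left (M μ) h1
  exact inBlock_blockOf_of_bpt L (fine n M) hN2
    (P := fun x μ => ‖R' x μ * star (taxiTv L (fine n M) R' (x + unitVec (fine L (fine n M)) μ)) * taxiTv L (fine n M) R' x - 1‖
      ≤ ((d - 1 : ℕ) : ℝ) * ((L - 1 : ℕ) : ℝ) * b)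
    (fun y j μ h => inBlock_defect_taxiTv_adjoint_le L (fine n M) hU hb y j μ h) x μ hx

/-- ONE⁺-colour's `hin` at taxi data with the common defect `m₁ = (d−1)(L−1)(2L−1)·b` (`hin_taxiTv_le`, `m_in ≤ m_cross`). [folklore] -/
theorem hin_taxi (hb0 : 0 ≤ b) (y : Tor (fine n M)) (j : Fin d → Fin L) (μ : Fin d) (h : (j μ : ℕ) + 1 < L) :
    ‖R' (bpt L (fine n M) y j) μ * star (taxiTv L (fine n M) R' (bpt L (fine n M) y j + unitVec (fine L (fine n M)) μ))
        - star (taxiTv L (fine n M) R' (bpt L (fine n M) y j))‖ ≤ ((d - 1 : ℕ) : ℝ) * ((L - 1 : ℕ) : ℝ) * ((2 * L - 1 : ℕ) : ℝ) * b := by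
  refine (hin_taxiTv_le L (fine n M) hU hb y j μ h).trans ?_
  have h1 : (1 : ℝ) ≤ ((2 * L - 1 : ℕ) : ℝ) := by have := NeZero.pos L; exact_mod_cast (show 1 ≤ 2 * L - 1 by omega)
  have h0 : 0 ≤ ((d - 1 : ℕ) : ℝ) * ((L - 1 : ℕ) : ℝ) * b := by positivity
  nlinarith

end Step

end Summit.QuantumFields.BalabanUV.T4Continuum.VariationalColourNestedTaxiFrames

end
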